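import Literature.NumberTheory.LFunctions.WeilArchimedeanPositivityProofs
import Literature.NumberTheory.LFunctions.WeilMarkovQuadratic
import HarnessLib

/-!
# GRH arm (rh-explicit, venture WeilGRH): the unramified local Euler form is non-negative on `h ⋆ h̃`

Cell `rh-explicit`, WEIL TRACK — GRH ARM (lit/typing seat weil-grh-5 gen12).  The analytic input of
`InducedCharacter.lean` (Weil positivity is MONOTONE under inducing a character to a larger modulus).

For a continuous compactly supported `h : ℝ → ℂ`, `k = h ⋆ h̃` (`k(x) = ∫ h(u) conj h(u − x) du`, the
tree's `weilConv h (weilReflect h)`), a lattice spacing `L > 0` and a complex number `z` with `‖z‖ ≤ 1`,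

  `Re ( k(0) + Σ_{m ≥ 1} ( z^m k(mL) + (conj z)^m k(−mL) ) ) ≥ 0`            (`re_localEulerForm_nonneg`).

With `L = log p`, `z = χ(p)/√p` this is `(log p)^{-1}` times the amount by which Weil's functional of
the character INDUCED by `χ` at a new prime `p` exceeds that of `χ` (the `n = p^m` prime terms of `χ`
plus the conductor gain `k(0) log p`), i.e. the local unramified Euler factor `|1 − χ(p)p^{−s}|^{−2}`
read on the critical line against `|ĥ|²` — a Poisson kernel, hence `≥ 0`.  The proof here is finite
and elementary (no Fourier analysis): fold `∫_ℝ` onto one period `[s₀, s₀ + L]`, and for each `s` apply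
the one-sided Kac–Murdock–Szegő sum of squares to the finite sequence `x_i = h(s + iL)`:
`Σ_j ( |x_j|² + 2 Re( x̄_j Σ_{m ≥ 1} z^m x_{j+m} ) ) = |y_0|² + (1 − |z|²) Σ_{j ≥ 1} |y_j|² ≥ 0`,
`y_j = Σ_{m ≥ 0} z^m x_{j+m}` (`kms_oneSided_nonneg`, proved by the telescoping
`|y_j|² − |z|²|y_{j+1}|² ≥ |y_j|² − |y_{j+1}|²`).

No definitions; no named facts; RH/GRH-free; standard axioms. [folklore: positivity of the Poisson /
Kac–Murdock–Szegő kernel `r^{|n|} e^{inθ}`, `0 ≤ r ≤ 1`]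
-/

set_option autoImplicit false

noncomputable section

open MeasureTheory Complex intervalIntegral
open scoped Real ComplexConjugate

namespace Summit.Ventures.WeilGRH

open Literature.NumberTheory.LFunctions

/-! ## 1. The one-sided Kac–Murdock–Szegő sum of squares -/

/-- **One-sided KMS positivity.** For `‖z‖ ≤ 1` and a sequence `x` vanishing from index `N' + 1` on,
`0 ≤ Σ_{j ≤ N'} ( ‖x_j‖² + 2 Re( conj x_j · Σ_{k < N'} z^{k+1} x_{j+k+1} ) )`.
With `y_j = Σ_{m ≤ N'} z^m x_{j+m}`: `y_j = x_j + z y_{j+1}`, the `j`-th term is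
`‖y_j‖² − ‖z‖²‖y_{j+1}‖² ≥ ‖y_j‖² − ‖y_{j+1}‖²`, and the sum telescopes to `‖y_0‖² − ‖y_{N'+1}‖² = ‖y_0‖²`.
[folklore: Kac–Murdock–Szegő / AR(1) Cholesky identity] -/
theorem kms_oneSided_nonneg {x : ℕ → ℂ} {z : ℂ} {N' : ℕ} (hz : ‖z‖ ≤ 1)
    (hx : ∀ i, N' + 1 ≤ i → x i = 0) :
    0 ≤ ∑ j ∈ Finset.range (N' + 1),
      (‖x j‖ ^ 2 + 2 * (conj (x j) * ∑ k ∈ Finset.range N', z ^ (k + 1) * x (j + (k + 1))).re) := by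
  set y : ℕ → ℂ := fun j ↦ ∑ m ∈ Finset.range (N' + 1), z ^ m * x (j + m) with hy
  have hT : ∀ j, ∑ k ∈ Finset.range N', z ^ (k + 1) * x (j + (k + 1)) = z * y (j + 1) := by
    intro j
    simp only [hy]
    rw [Finset.sum_range_succ, hx (j + 1 + N') (by omega), mul_zero, add_zero, Finset.mul_sum]
    refine Finset.sum_congr rfl fun k _ ↦ ?_
    rw [pow_succ', mul_assoc, show j + (k + 1) = j + 1 + k by omega]
  have hrec : ∀ j, y j = x j + z * y (j + 1) := by
    intro j
    rw [← hT j]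
    simp only [hy]
    rw [Finset.sum_range_succ']
    simp only [pow_zero, one_mul, add_zero]
    ring
  have hyN : y (N' + 1) = 0 :=
    Finset.sum_eq_zero fun m _ ↦ by rw [hx _ (by omega), mul_zero]
  have hterm : ∀ j,
      ‖x j‖ ^ 2 + 2 * (conj (x j) * ∑ k ∈ Finset.range N', z ^ (k + 1) * x (j + (k + 1))).re
        = ‖y j‖ ^ 2 - ‖z‖ ^ 2 * ‖y (j + 1)‖ ^ 2 := by
    intro j
    have hre : (x j * conj (z * y (j + 1))).re = (conj (x j) * (z * y (j + 1))).re := by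
      rw [← Complex.conj_re (x j * conj (z * y (j + 1)))]
      simp only [map_mul, Complex.conj_conj]
    rw [hT j]
    conv_rhs => rw [hrec j]
    simp only [Complex.sq_norm]
    rw [Complex.normSq_add, Complex.normSq_mul, hre]
    ring
  calc (0 : ℝ) ≤ ‖y 0‖ ^ 2 := by positivity
    _ = ‖y 0‖ ^ 2 - ‖y (N' + 1)‖ ^ 2 := by rw [hyN, norm_zero]; ring
    _ = ∑ j ∈ Finset.range (N' + 1), (‖y j‖ ^ 2 - ‖y (j + 1)‖ ^ 2) :=
        (Finset.sum_range_sub' (fun j ↦ ‖y j‖ ^ 2) (N' + 1)).symm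
    _ ≤ ∑ j ∈ Finset.range (N' + 1), (‖y j‖ ^ 2 - ‖z‖ ^ 2 * ‖y (j + 1)‖ ^ 2) :=
        Finset.sum_le_sum fun j _ ↦ by
          have hz2 : ‖z‖ ^ 2 ≤ 1 := pow_le_one₀ (norm_nonneg _) hz
          nlinarith [sq_nonneg ‖y (j + 1)‖]
    _ = _ := Finset.sum_congr rfl fun j _ ↦ (hterm j).symm

/-! ## 2. Folding `∫_ℝ` onto one period -/

/-- **Folding.** If `F` is continuous and vanishes off `(s₀, s₀ + N L]`, then
`∫_ℝ F = Σ_{j < N} ∫_{s₀}^{s₀+L} F(s + jL) ds`. [folklore] -/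
theorem integral_eq_sum_integral_translate {E : Type*} [NormedAddCommGroup E] [NormedSpace ℝ E]
    [CompleteSpace E] {F : ℝ → E} (hF : Continuous F) {s₀ L : ℝ} {N : ℕ}
    (hsupp : Function.support F ⊆ Set.Ioc s₀ (s₀ + N * L)) :
    ∫ x, F x = ∑ j ∈ Finset.range N, ∫ s in s₀..s₀ + L, F (s + j * L) := by
  rw [← intervalIntegral.integral_eq_integral_of_support_subset hsupp]
  have hadj := intervalIntegral.sum_integral_adjacent_intervals (f := F) (μ := volume)
    (a := fun k : ℕ ↦ s₀ + k * L) (n := N) fun k _ ↦ hF.intervalIntegrable _ _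
  simp only [Nat.cast_zero, zero_mul, add_zero] at hadj
  rw [← hadj]
  refine Finset.sum_congr rfl fun j _ ↦ ?_
  rw [intervalIntegral.integral_comp_add_right F ((j : ℝ) * L)]
  congr 1
  push_cast
  ring

/-! ## 3. The local Euler form on `h ⋆ h̃` -/

/-- `k(t) = ∫ conj h(w) · h(w + t) dw` (substitute `u = w + t` in `k(t) = ∫ h(u) conj h(u − t) du`). [folklore] -/
theorem weilConv_weilReflect_eq_integral_conj_mul (h : ℝ → ℂ) (t : ℝ) :
    weilConv h (weilReflect h) t = ∫ w, conj (h w) * h (w + t) := by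
  rw [weilConv_apply, ← integral_add_right_eq_self (fun u : ℝ ↦ h u * weilReflect h (t - u)) t]
  refine integral_congr_ae (Filter.Eventually.of_forall fun w ↦ ?_)
  simp only [weilReflect, show -(t - (w + t)) = w by ring]
  ring

/-- **The folded density is non-negative.** For `h` continuous with `h = 0` off `[−R, R]`, `L > 0`,
`R + L ≤ K L`, `‖z‖ ≤ 1`:
`0 ≤ ∫_ℝ ( |h(w)|² + Σ_{m < 2K} 2 Re( z^{m+1} conj h(w) · h(w + (m+1)L) ) ) dw`
(fold onto `[−KL, −KL + L]`, then `kms_oneSided_nonneg` pointwise with `x_i = h(s + iL)`).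
[folklore: Poisson / Kac–Murdock–Szegő kernel positivity] -/
theorem integral_localEulerDensity_nonneg {h : ℝ → ℂ} (hh : Continuous h) {R L : ℝ} (hR0 : 0 ≤ R)
    (hL : 0 < L) (hzero : ∀ x, R < |x| → h x = 0) {K : ℕ} (hKL : R + L ≤ K * L) {z : ℂ}
    (hz : ‖z‖ ≤ 1) :
    0 ≤ ∫ w, (‖h w‖ ^ 2 + ∑ m ∈ Finset.range (2 * K),
      2 * (z ^ (m + 1) * (conj (h w) * h (w + ((m + 1 : ℕ) : ℝ) * L))).re) := by
  set Φ : ℝ → ℝ := fun w ↦ ‖h w‖ ^ 2 + ∑ m ∈ Finset.range (2 * K),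
      2 * (z ^ (m + 1) * (conj (h w) * h (w + ((m + 1 : ℕ) : ℝ) * L))).re with hΦdef
  have hΦ_cont : Continuous Φ := by
    refine (hh.norm.pow 2).add (continuous_finsetSum _ fun m _ ↦ continuous_const.mul ?_)
    exact Complex.continuous_re.comp (continuous_const.mul
      ((Complex.continuous_conj.comp hh).mul (hh.comp (continuous_add_const _))))
  -- support of `Φ` inside one block of `2K + 1` periods starting at `s₀ = −KL`
  have hΦ_supp : Function.support Φ ⊆ Set.Ioc (-(K * L)) (-(K * L) + ((2 * K + 1 : ℕ) : ℝ) * L) := by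
    intro w hw
    rw [Function.mem_support] at hw
    have hw' : h w ≠ 0 := by
      intro h0
      apply hw
      simp only [hΦdef, h0, norm_zero, map_zero, zero_mul, mul_zero, Complex.zero_re,
        Finset.sum_const_zero, add_zero]
      norm_num
    have habs : |w| ≤ R := by
      by_contra hcon
      exact hw' (hzero w (not_le.mp hcon))
    rw [abs_le] at habs
    have h1 : ((2 * K + 1 : ℕ) : ℝ) * L = 2 * (K * L) + L := by push_cast; ring
    rw [Set.mem_Ioc, h1]
    constructor <;> linarith
  have hfold := integral_eq_sum_integral_translate hΦ_cont hΦ_supp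
  -- pointwise positivity on the period via KMS
  have hpt : ∀ s ∈ Set.Icc (-(K * L)) (-(K * L) + L),
      0 ≤ ∑ j ∈ Finset.range (2 * K + 1), Φ (s + j * L) := by
    intro s hs
    rw [Set.mem_Icc] at hs
    set x : ℕ → ℂ := fun i ↦ h (s + i * L) with hxdef
    have hx : ∀ i, 2 * K + 1 ≤ i → x i = 0 := by
      intro i hi
      apply hzero
      have h1 : ((2 * K + 1 : ℕ) : ℝ) ≤ (i : ℝ) := by exact_mod_cast hi
      have h2 : ((2 * K + 1 : ℕ) : ℝ) * L ≤ (i : ℝ) * L := mul_le_mul_of_nonneg_right h1 hL.le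
      have h3 : ((2 * K + 1 : ℕ) : ℝ) * L = 2 * (K * L) + L := by push_cast; ring
      have h4 : R < s + i * L := by linarith
      rwa [abs_of_pos (hR0.trans_lt h4)]
    have hkms := kms_oneSided_nonneg (x := x) (z := z) (N' := 2 * K) hz hx
    refine hkms.trans_eq (Finset.sum_congr rfl fun j _ ↦ ?_)
    have hxm : ∀ m : ℕ, h (s + (j : ℝ) * L + ((m + 1 : ℕ) : ℝ) * L) = x (j + (m + 1)) := by
      intro m
      simp only [hxdef]
      congr 1
      push_cast
      ring
    simp only [hΦdef]
    rw [Finset.mul_sum, Complex.re_sum, Finset.mul_sum]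
    congr 1
    refine Finset.sum_congr rfl fun m _ ↦ ?_
    rw [hxm m, mul_left_comm]
  -- assemble
  have hint_j : ∀ j ∈ Finset.range (2 * K + 1),
      IntervalIntegrable (fun s ↦ Φ (s + (j : ℝ) * L)) volume (-(K * L)) (-(K * L) + L) :=
    fun j _ ↦ (hΦ_cont.comp (continuous_add_const _)).intervalIntegrable _ _
  rw [hfold, ← intervalIntegral.integral_finsetSum hint_j]
  exact intervalIntegral.integral_nonneg (by linarith) hpt

/-- **Positivity of the unramified local Euler form on `h ⋆ h̃`.**  For `h` continuous with compact
support, `k = h ⋆ h̃`, `L > 0`, `‖z‖ ≤ 1`: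
`0 ≤ Re ( k(0) + Σ'_{m} ( z^{m+1} k((m+1)L) + (conj z)^{m+1} k(−(m+1)L) ) )`.
(With `L = log p`, `z = χ(p)/√p`: the gain of Weil's functional under inducing `χ` at the prime `p`,
divided by `log p`.)  [folklore: Poisson / Kac–Murdock–Szegő kernel positivity] -/
theorem re_localEulerForm_nonneg {h : ℝ → ℂ} (hh : Continuous h) (hsupp : HasCompactSupport h)
    {L : ℝ} (hL : 0 < L) {z : ℂ} (hz : ‖z‖ ≤ 1) :
    0 ≤ (weilConv h (weilReflect h) 0 +
      ∑' m : ℕ, (z ^ (m + 1) * weilConv h (weilReflect h) (((m + 1 : ℕ) : ℝ) * L) +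
        conj z ^ (m + 1) * weilConv h (weilReflect h) (-(((m + 1 : ℕ) : ℝ) * L)))).re := by
  set k : ℝ → ℂ := weilConv h (weilReflect h) with hkdef
  have hk_neg : ∀ t, k (-t) = conj (k t) := fun t ↦ weilConv_weilReflect_neg h t
  -- support radius `R ≥ 0`
  obtain ⟨r, hr⟩ := hsupp.isCompact.isBounded.subset_closedBall 0
  set R : ℝ := max r 0 with hRdef
  have hR0 : 0 ≤ R := le_max_right _ _
  have htsupp : tsupport h ⊆ Set.Icc (-R) R := by
    refine hr.trans fun x hx ↦ ?_
    rw [Metric.mem_closedBall, dist_zero_right, Real.norm_eq_abs] at hx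
    have h1 := neg_abs_le x
    have h2 := le_abs_self x
    have h3 := le_max_left r 0
    exact ⟨by linarith, by linarith⟩
  have hzero : ∀ x, R < |x| → h x = 0 := fun x hx ↦
    image_eq_zero_of_notMem_tsupport fun hxs ↦ by
      have h1 := htsupp hxs
      rw [Set.mem_Icc] at h1
      have := abs_le.mpr ⟨h1.1, h1.2⟩
      linarith
  have hkzero : ∀ t, 2 * R < |t| → k t = 0 := fun t ht ↦
    image_eq_zero_of_notMem_tsupport fun hts ↦ by
      have h1 := tsupport_weilConv_weilReflect_subset hsupp htsupp hts
      rw [Set.mem_Icc] at h1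
      have := abs_le.mpr ⟨by linarith [h1.1], h1.2⟩
      linarith
  -- the cut-offs `K`, `N' = 2K`
  set K : ℕ := ⌈R / L⌉₊ + 1 with hKdef
  have hKL : R + L ≤ K * L := by
    have h1 : R / L ≤ ⌈R / L⌉₊ := Nat.le_ceil _
    have h2 : (K : ℝ) = ⌈R / L⌉₊ + 1 := by simp only [hKdef, Nat.cast_add, Nat.cast_one]
    have h3 : R ≤ (⌈R / L⌉₊ : ℝ) * L := by
      calc R = R / L * L := (div_mul_cancel₀ R hL.ne').symm
        _ ≤ _ := mul_le_mul_of_nonneg_right h1 hL.le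
    rw [h2, add_mul, one_mul]
    linarith
  have ht_pos : ∀ m : ℕ, 0 < ((m + 1 : ℕ) : ℝ) * L := fun m ↦ by positivity
  -- Step 1: the series is a finite sum; its real part is `(k 0).re + Σ 2 Re(z^(m+1) k((m+1)L))`
  have htail : ∀ m, m ∉ Finset.range (2 * K) → k (((m + 1 : ℕ) : ℝ) * L) = 0 := by
    intro m hm
    rw [Finset.mem_range, not_lt] at hm
    apply hkzero
    rw [abs_of_pos (ht_pos m)]
    have h1 : ((2 * K : ℕ) : ℝ) + 1 ≤ ((m + 1 : ℕ) : ℝ) := by exact_mod_cast Nat.succ_le_succ hm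
    have h2 : (((2 * K : ℕ) : ℝ) + 1) * L ≤ ((m + 1 : ℕ) : ℝ) * L :=
      mul_le_mul_of_nonneg_right h1 hL.le
    have h3 : (((2 * K : ℕ) : ℝ) + 1) * L = 2 * (K * L) + L := by push_cast; ring
    linarith
  have hsum : ∑' m : ℕ, (z ^ (m + 1) * k (((m + 1 : ℕ) : ℝ) * L) + conj z ^ (m + 1) * k (-(((m + 1 : ℕ) : ℝ) * L))) =
      ∑ m ∈ Finset.range (2 * K), (z ^ (m + 1) * k (((m + 1 : ℕ) : ℝ) * L) + conj (z ^ (m + 1) * k (((m + 1 : ℕ) : ℝ) * L))) := by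
    rw [tsum_eq_sum (s := Finset.range (2 * K)) fun m hm ↦ by
      rw [hk_neg, htail m hm, map_zero, mul_zero, mul_zero, add_zero]]
    refine Finset.sum_congr rfl fun m _ ↦ ?_
    rw [hk_neg, map_mul, map_pow]
  have hre_eq : (k 0 + ∑' m : ℕ, (z ^ (m + 1) * k (((m + 1 : ℕ) : ℝ) * L) + conj z ^ (m + 1) * k (-(((m + 1 : ℕ) : ℝ) * L)))).re =
      (k 0).re + ∑ m ∈ Finset.range (2 * K), 2 * (z ^ (m + 1) * k (((m + 1 : ℕ) : ℝ) * L)).re := by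
    rw [hsum, Complex.add_re, Complex.re_sum]
    congr 1
    refine Finset.sum_congr rfl fun m _ ↦ ?_
    rw [Complex.add_conj, Complex.ofReal_re]
  -- Step 2: each term as an integral over `ℝ`
  have hk0 : (k 0).re = ∫ w, ‖h w‖ ^ 2 := by
    simp only [hkdef]
    rw [weilConv_weilReflect_apply_zero, Complex.ofReal_re]
  have hint : ∀ s : ℝ → ℂ, Continuous s → Integrable (fun w ↦ conj (h w) * s w) := by
    intro s hs
    refine Continuous.integrable_of_hasCompactSupport ((Complex.continuous_conj.comp hh).mul hs) ?_
    exact (hsupp.comp_left (g := fun v : ℂ ↦ conj v) (map_zero _)).mul_right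
  have hint' : ∀ m, Integrable (fun w ↦ z ^ (m + 1) * (conj (h w) * h (w + ((m + 1 : ℕ) : ℝ) * L))) := fun m ↦
    (hint _ (hh.comp (continuous_add_const _))).const_mul _
  have hterm : ∀ m, (z ^ (m + 1) * k (((m + 1 : ℕ) : ℝ) * L)).re =
      ∫ w, (z ^ (m + 1) * (conj (h w) * h (w + ((m + 1 : ℕ) : ℝ) * L))).re := by
    intro m
    have h1 : k (((m + 1 : ℕ) : ℝ) * L) = ∫ w, conj (h w) * h (w + ((m + 1 : ℕ) : ℝ) * L) :=
      weilConv_weilReflect_eq_integral_conj_mul h _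
    rw [h1, ← MeasureTheory.integral_const_mul]
    exact (integral_re (hint' m)).symm
  have hint_re : ∀ m, Integrable (fun w ↦ 2 * (z ^ (m + 1) * (conj (h w) * h (w + ((m + 1 : ℕ) : ℝ) * L))).re) :=
    fun m ↦ (hint' m).re.const_mul _
  have hcs : HasCompactSupport (fun w ↦ ‖h w‖ ^ 2) := by
    have := hsupp.norm.mul_right (f' := fun w ↦ ‖h w‖)
    simpa only [Pi.mul_def, sq] using this
  have hint_sq : Integrable (fun w ↦ ‖h w‖ ^ 2) := (hh.norm.pow 2).integrable_of_hasCompactSupport hcs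
  have htotal : (k 0).re + ∑ m ∈ Finset.range (2 * K), 2 * (z ^ (m + 1) * k (((m + 1 : ℕ) : ℝ) * L)).re =
      ∫ w, (‖h w‖ ^ 2 + ∑ m ∈ Finset.range (2 * K),
        2 * (z ^ (m + 1) * (conj (h w) * h (w + ((m + 1 : ℕ) : ℝ) * L))).re) := by
    rw [integral_add hint_sq (integrable_finsetSum _ fun m _ ↦ hint_re m),
      integral_finsetSum _ fun m _ ↦ hint_re m, hk0]
    congr 1
    refine Finset.sum_congr rfl fun m _ ↦ ?_
    rw [hterm m, ← MeasureTheory.integral_const_mul]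
  -- Step 3: conclude with the folded density
  rw [hre_eq, htotal]
  exact integral_localEulerDensity_nonneg hh hR0 hL hzero hKL hz

end Summit.Ventures.WeilGRH

end
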